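import Summits.Ventures.PercRepro2.CaseOneCubicI
import Summits.Ventures.PercRepro2.CaseOneStarMain
import Summits.Ventures.PercRepro2.CaseOneStarMassQB1
import Summits.Ventures.PercRepro2.CaseOneStarMassQAB1
import Summits.Ventures.PercRepro2.CaseOneStarMassQAB1O
import Summits.Ventures.PercRepro2.CaseOneStarCertI00a
import Summits.Ventures.PercRepro2.CaseOneStarCertI00b
import Summits.Ventures.PercRepro2.CaseOneStarCertI01a
import Summits.Ventures.PercRepro2.CaseOneStarCertI01b
import Summits.Ventures.PercRepro2.CaseOneStarCertI10a
import Summits.Ventures.PercRepro2.CaseOneStarCertI10b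
import Summits.Ventures.PercRepro2.CaseOneStarCertI10c
import Summits.Ventures.PercRepro2.CaseOneStarCertI11a
import Summits.Ventures.PercRepro2.CaseOneStarCertI11b
import Summits.Ventures.PercRepro2.CaseOneStarCertI11c
import Summits.Ventures.PercRepro2.CaseOneStarCertI20
import Summits.Ventures.PercRepro2.CaseOneStarBlockI21

/-!
# The marked star: `(i)` and `(J1₁)` for every `a₃` adjacent exactly to `a₁, a₂, o, b`
(blind cell PercRepro2, p1 g15; S5 §2.1 (K9) (p), proofs/P1-TWOMARK.md §4′)

`iExpr_eq_iQ4`: `iExpr` is the polynomial `iQ4` at the edge weights and the cell masses of the pinned law;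
`iQ4_nonneg` from `iQ4 = (1 − q₁)(1 − q₂)² · EredI` and the six certified `epsI_ij`; hence
**`zSplitI_of_markedStar`** and, with `zSplitII_of_markedStar`, **`jOneOne_of_markedStar`**: `(i)`, `(ii)`
and `(J1₁)` for every finite graph, every weight vector, every `a₃` whose edges are exactly the four
edges to `a₁, a₂, o, b`. -/

namespace Summit.Ventures.PercRepro2

namespace CaseOne

section MainI4
variable {R : Type*} [Field R] [LinearOrder R] [IsStrictOrderedRing R]

/-- **`iQ4 ≥ 0`** for weights in `[0, 1]` and cells satisfying the facts. -/
theorem iQ4_nonneg (q₁ q₂ r s : R) (m : SCells R) (hf : SFacts m)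
    (hq₁ : 0 ≤ q₁) (hq₁' : q₁ ≤ 1) (hq₂ : 0 ≤ q₂) (hq₂' : q₂ ≤ 1) (hr : 0 ≤ r) (hr' : r ≤ 1)
    (hs : 0 ≤ s) (hs' : s ≤ 1) : 0 ≤ iQ4 q₁ q₂ r s m := by
  have hq₁1 : 0 ≤ 1 - q₁ := sub_nonneg.2 hq₁'
  have hq₂1 : 0 ≤ 1 - q₂ := sub_nonneg.2 hq₂'
  have heps00 : 0 ≤ epsI00 r s m := epsI00_nonneg r s m hf hr hr' hs hs'
  have heps01 : 0 ≤ epsI01 r s m := epsI01_nonneg r s m hf hr hr' hs hs'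
  have heps10 : 0 ≤ epsI10 r s m := epsI10_nonneg r s m hf hr hr' hs hs'
  have heps11 : 0 ≤ epsI11 r s m := epsI11_nonneg r s m hf hr hr' hs hs'
  have heps20 : 0 ≤ epsI20 r s m := epsI20_nonneg r s m hf hr hr' hs hs'
  have heps21 : 0 ≤ epsI21 r s m := by
    have key := epsI21_bern r s m
    linarith only [key]
  have hE : 0 ≤ EredI q₁ q₂ r s m := by
    have key := EredI_bern q₁ q₂ r s m
    have w2 : ∀ (c : R) (i j : ℕ), 0 ≤ c → 0 ≤ c * q₁ ^ i * (1 - q₁) ^ (2 - i) * q₂ ^ j * (1 - q₂) ^ (1 - j) :=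
      fun c i j hc => mul_nonneg (mul_nonneg (mul_nonneg (mul_nonneg hc (pow_nonneg hq₁ _)) (pow_nonneg hq₁1 _))
        (pow_nonneg hq₂ _)) (pow_nonneg hq₂1 _)
    have e00 : 0 ≤ (1 : R) * q₁ ^ 0 * (1 - q₁) ^ 2 * q₂ ^ 0 * (1 - q₂) ^ 1 * epsI00 r s m := mul_nonneg (w2 1 0 0 (by norm_num)) heps00
    have e01 : 0 ≤ (1 : R) * q₁ ^ 0 * (1 - q₁) ^ 2 * q₂ ^ 1 * (1 - q₂) ^ 0 * epsI01 r s m := mul_nonneg (w2 1 0 1 (by norm_num)) heps01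
    have e10 : 0 ≤ (2 : R) * q₁ ^ 1 * (1 - q₁) ^ 1 * q₂ ^ 0 * (1 - q₂) ^ 1 * epsI10 r s m := mul_nonneg (w2 2 1 0 (by norm_num)) heps10
    have e11 : 0 ≤ (2 : R) * q₁ ^ 1 * (1 - q₁) ^ 1 * q₂ ^ 1 * (1 - q₂) ^ 0 * epsI11 r s m := mul_nonneg (w2 2 1 1 (by norm_num)) heps11
    have e20 : 0 ≤ (1 : R) * q₁ ^ 2 * (1 - q₁) ^ 0 * q₂ ^ 0 * (1 - q₂) ^ 1 * epsI20 r s m := mul_nonneg (w2 1 2 0 (by norm_num)) heps20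
    have e21 : 0 ≤ (1 : R) * q₁ ^ 2 * (1 - q₁) ^ 0 * q₂ ^ 1 * (1 - q₂) ^ 0 * epsI21 r s m := mul_nonneg (w2 1 2 1 (by norm_num)) heps21
    have h2 : 0 ≤ 2 * EredI q₁ q₂ r s m := by
      rw [key]
      exact add_nonneg (add_nonneg (add_nonneg (add_nonneg (add_nonneg e00 e01) e10) e11) e20) e21
    linarith only [h2]
  rw [iQ4_factor]
  exact mul_nonneg (mul_nonneg hq₁1 (pow_nonneg hq₂1 _)) hE

end MainI4

section ClosedI4
variable {V : Type*} {E : Type*} [Fintype E] [DecidableEq E] [Fintype V] [DecidableEq V]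
  {R : Type*} [Field R] [LinearOrder R] [IsStrictOrderedRing R]
variable {ends : E → Sym2 V} {o a₁ a₂ b a₃ : V} {e₁ e₂ eo eb : E}

omit [Fintype V] [DecidableEq V] [LinearOrder R] [IsStrictOrderedRing R] in
/-- The mass polynomial `smQB1` at the cell masses is the mixture of `mass_QB1`. -/
lemma smQB1_mix (p : E → R) (e₁ e₂ eo eb : E) :
    smQB1 (p e₁) (p e₂) (p eo) (p eb) (scells (pin4 p e₁ e₂ eo eb) ends o a₁ a₂ b) =
      p e₁ * p e₂ * p eo * p eb * 0 +
      p e₁ * p e₂ * p eo * (1 - p eb) * 0 +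
      p e₁ * p e₂ * (1 - p eo) * p eb * 0 +
      p e₁ * p e₂ * (1 - p eo) * (1 - p eb) * 0 +
      p e₁ * (1 - p e₂) * p eo * p eb * (cellMass (pin4 p e₁ e₂ eo eb) ends o a₁ a₂ b 1 + cellMass (pin4 p e₁ e₂ eo eb) ends o a₁ a₂ b 3 + cellMass (pin4 p e₁ e₂ eo eb) ends o a₁ a₂ b 4 + cellMass (pin4 p e₁ e₂ eo eb) ends o a₁ a₂ b 9 + cellMass (pin4 p e₁ e₂ eo eb) ends o a₁ a₂ b 10) +
      p e₁ * (1 - p e₂) * p eo * (1 - p eb) * (cellMass (pin4 p e₁ e₂ eo eb) ends o a₁ a₂ b 1 + cellMass (pin4 p e₁ e₂ eo eb) ends o a₁ a₂ b 4 + cellMass (pin4 p e₁ e₂ eo eb) ends o a₁ a₂ b 10) +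
      p e₁ * (1 - p e₂) * (1 - p eo) * p eb * (cellMass (pin4 p e₁ e₂ eo eb) ends o a₁ a₂ b 1 + cellMass (pin4 p e₁ e₂ eo eb) ends o a₁ a₂ b 3 + cellMass (pin4 p e₁ e₂ eo eb) ends o a₁ a₂ b 4 + cellMass (pin4 p e₁ e₂ eo eb) ends o a₁ a₂ b 6 + cellMass (pin4 p e₁ e₂ eo eb) ends o a₁ a₂ b 7 + cellMass (pin4 p e₁ e₂ eo eb) ends o a₁ a₂ b 9 + cellMass (pin4 p e₁ e₂ eo eb) ends o a₁ a₂ b 10) +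
      p e₁ * (1 - p e₂) * (1 - p eo) * (1 - p eb) * (cellMass (pin4 p e₁ e₂ eo eb) ends o a₁ a₂ b 1 + cellMass (pin4 p e₁ e₂ eo eb) ends o a₁ a₂ b 4 + cellMass (pin4 p e₁ e₂ eo eb) ends o a₁ a₂ b 7) +
      (1 - p e₁) * p e₂ * p eo * p eb * 0 +
      (1 - p e₁) * p e₂ * p eo * (1 - p eb) * (cellMass (pin4 p e₁ e₂ eo eb) ends o a₁ a₂ b 1 + cellMass (pin4 p e₁ e₂ eo eb) ends o a₁ a₂ b 7) +
      (1 - p e₁) * p e₂ * (1 - p eo) * p eb * 0 +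
      (1 - p e₁) * p e₂ * (1 - p eo) * (1 - p eb) * (cellMass (pin4 p e₁ e₂ eo eb) ends o a₁ a₂ b 1 + cellMass (pin4 p e₁ e₂ eo eb) ends o a₁ a₂ b 4 + cellMass (pin4 p e₁ e₂ eo eb) ends o a₁ a₂ b 7) +
      (1 - p e₁) * (1 - p e₂) * p eo * p eb * (cellMass (pin4 p e₁ e₂ eo eb) ends o a₁ a₂ b 1 + cellMass (pin4 p e₁ e₂ eo eb) ends o a₁ a₂ b 3 + cellMass (pin4 p e₁ e₂ eo eb) ends o a₁ a₂ b 4) +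
      (1 - p e₁) * (1 - p e₂) * p eo * (1 - p eb) * (cellMass (pin4 p e₁ e₂ eo eb) ends o a₁ a₂ b 1 + cellMass (pin4 p e₁ e₂ eo eb) ends o a₁ a₂ b 4 + cellMass (pin4 p e₁ e₂ eo eb) ends o a₁ a₂ b 7) +
      (1 - p e₁) * (1 - p e₂) * (1 - p eo) * p eb * (cellMass (pin4 p e₁ e₂ eo eb) ends o a₁ a₂ b 1 + cellMass (pin4 p e₁ e₂ eo eb) ends o a₁ a₂ b 4 + cellMass (pin4 p e₁ e₂ eo eb) ends o a₁ a₂ b 7) +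
      (1 - p e₁) * (1 - p e₂) * (1 - p eo) * (1 - p eb) * (cellMass (pin4 p e₁ e₂ eo eb) ends o a₁ a₂ b 1 + cellMass (pin4 p e₁ e₂ eo eb) ends o a₁ a₂ b 4 + cellMass (pin4 p e₁ e₂ eo eb) ends o a₁ a₂ b 7) := by
  unfold smQB1 scells
  ring

omit [Fintype V] [DecidableEq V] [LinearOrder R] [IsStrictOrderedRing R] in
/-- The mass polynomial `smQAB1` at the cell masses is the mixture of `mass_QAB1`. -/
lemma smQAB1_mix (p : E → R) (e₁ e₂ eo eb : E) :
    smQAB1 (p e₁) (p e₂) (p eo) (p eb) (scells (pin4 p e₁ e₂ eo eb) ends o a₁ a₂ b) =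
      p e₁ * p e₂ * p eo * p eb * 0 +
      p e₁ * p e₂ * p eo * (1 - p eb) * 0 +
      p e₁ * p e₂ * (1 - p eo) * p eb * 0 +
      p e₁ * p e₂ * (1 - p eo) * (1 - p eb) * 0 +
      p e₁ * (1 - p e₂) * p eo * p eb * (cellMass (pin4 p e₁ e₂ eo eb) ends o a₁ a₂ b 1 + cellMass (pin4 p e₁ e₂ eo eb) ends o a₁ a₂ b 3 + cellMass (pin4 p e₁ e₂ eo eb) ends o a₁ a₂ b 4 + cellMass (pin4 p e₁ e₂ eo eb) ends o a₁ a₂ b 9 + cellMass (pin4 p e₁ e₂ eo eb) ends o a₁ a₂ b 10) +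
      p e₁ * (1 - p e₂) * p eo * (1 - p eb) * (cellMass (pin4 p e₁ e₂ eo eb) ends o a₁ a₂ b 1 + cellMass (pin4 p e₁ e₂ eo eb) ends o a₁ a₂ b 4 + cellMass (pin4 p e₁ e₂ eo eb) ends o a₁ a₂ b 10) +
      p e₁ * (1 - p e₂) * (1 - p eo) * p eb * (cellMass (pin4 p e₁ e₂ eo eb) ends o a₁ a₂ b 1 + cellMass (pin4 p e₁ e₂ eo eb) ends o a₁ a₂ b 3 + cellMass (pin4 p e₁ e₂ eo eb) ends o a₁ a₂ b 4 + cellMass (pin4 p e₁ e₂ eo eb) ends o a₁ a₂ b 6 + cellMass (pin4 p e₁ e₂ eo eb) ends o a₁ a₂ b 7 + cellMass (pin4 p e₁ e₂ eo eb) ends o a₁ a₂ b 9 + cellMass (pin4 p e₁ e₂ eo eb) ends o a₁ a₂ b 10) +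
      p e₁ * (1 - p e₂) * (1 - p eo) * (1 - p eb) * (cellMass (pin4 p e₁ e₂ eo eb) ends o a₁ a₂ b 1 + cellMass (pin4 p e₁ e₂ eo eb) ends o a₁ a₂ b 4 + cellMass (pin4 p e₁ e₂ eo eb) ends o a₁ a₂ b 7) +
      (1 - p e₁) * p e₂ * p eo * p eb * 0 +
      (1 - p e₁) * p e₂ * p eo * (1 - p eb) * 0 +
      (1 - p e₁) * p e₂ * (1 - p eo) * p eb * 0 +
      (1 - p e₁) * p e₂ * (1 - p eo) * (1 - p eb) * 0 +
      (1 - p e₁) * (1 - p e₂) * p eo * p eb * (cellMass (pin4 p e₁ e₂ eo eb) ends o a₁ a₂ b 1 + cellMass (pin4 p e₁ e₂ eo eb) ends o a₁ a₂ b 3 + cellMass (pin4 p e₁ e₂ eo eb) ends o a₁ a₂ b 4) +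
      (1 - p e₁) * (1 - p e₂) * p eo * (1 - p eb) * (cellMass (pin4 p e₁ e₂ eo eb) ends o a₁ a₂ b 4) +
      (1 - p e₁) * (1 - p e₂) * (1 - p eo) * p eb * (cellMass (pin4 p e₁ e₂ eo eb) ends o a₁ a₂ b 1 + cellMass (pin4 p e₁ e₂ eo eb) ends o a₁ a₂ b 4 + cellMass (pin4 p e₁ e₂ eo eb) ends o a₁ a₂ b 7) +
      (1 - p e₁) * (1 - p e₂) * (1 - p eo) * (1 - p eb) * 0 := by
  unfold smQAB1 scells
  ring

omit [Fintype V] [DecidableEq V] [LinearOrder R] [IsStrictOrderedRing R] in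
/-- The mass polynomial `smQAB1O` at the cell masses is the mixture of `mass_QAB1O`. -/
lemma smQAB1O_mix (p : E → R) (e₁ e₂ eo eb : E) :
    smQAB1O (p e₁) (p e₂) (p eo) (p eb) (scells (pin4 p e₁ e₂ eo eb) ends o a₁ a₂ b) =
      p e₁ * p e₂ * p eo * p eb * 0 +
      p e₁ * p e₂ * p eo * (1 - p eb) * 0 +
      p e₁ * p e₂ * (1 - p eo) * p eb * 0 +
      p e₁ * p e₂ * (1 - p eo) * (1 - p eb) * 0 +
      p e₁ * (1 - p e₂) * p eo * p eb * 0 +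
      p e₁ * (1 - p e₂) * p eo * (1 - p eb) * 0 +
      p e₁ * (1 - p e₂) * (1 - p eo) * p eb * (cellMass (pin4 p e₁ e₂ eo eb) ends o a₁ a₂ b 6 + cellMass (pin4 p e₁ e₂ eo eb) ends o a₁ a₂ b 7) +
      p e₁ * (1 - p e₂) * (1 - p eo) * (1 - p eb) * (cellMass (pin4 p e₁ e₂ eo eb) ends o a₁ a₂ b 7) +
      (1 - p e₁) * p e₂ * p eo * p eb * 0 +
      (1 - p e₁) * p e₂ * p eo * (1 - p eb) * 0 +
      (1 - p e₁) * p e₂ * (1 - p eo) * p eb * 0 +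
      (1 - p e₁) * p e₂ * (1 - p eo) * (1 - p eb) * 0 +
      (1 - p e₁) * (1 - p e₂) * p eo * p eb * 0 +
      (1 - p e₁) * (1 - p e₂) * p eo * (1 - p eb) * 0 +
      (1 - p e₁) * (1 - p e₂) * (1 - p eo) * p eb * (cellMass (pin4 p e₁ e₂ eo eb) ends o a₁ a₂ b 7) +
      (1 - p e₁) * (1 - p e₂) * (1 - p eo) * (1 - p eb) * 0 := by
  unfold smQAB1O scells
  ring

omit [Fintype V] [DecidableEq V] [LinearOrder R] [IsStrictOrderedRing R] in
/-- **`iExpr` is `iQ4`** at the four edge weights and the cell masses of the pinned law. -/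
theorem iExpr_eq_iQ4 (p : E → R) (h : IsMarkedStarAt ends o a₁ a₂ b a₃ e₁ e₂ eo eb) :
    iExpr p ends o a₁ a₂ a₃ b =
      iQ4 (p e₁) (p e₂) (p eo) (p eb) (scells (pin4 p e₁ e₂ eo eb) ends o a₁ a₂ b) := by
  rw [iExpr_eq_probs', mass_Q p h, mass_QA p h, mass_QAO p h, mass_D p h, mass_Do p h, mass_QB1 p h,
    mass_QAB1 p h, mass_QAB1O p h, ← smQ_mix p e₁ e₂ eo eb, ← smQA_mix p e₁ e₂ eo eb,
    ← smQAO_mix p e₁ e₂ eo eb, ← smD_mix p e₁ e₂ eo eb, ← smDo_mix p e₁ e₂ eo eb, ← smQB1_mix p e₁ e₂ eo eb,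
    ← smQAB1_mix p e₁ e₂ eo eb, ← smQAB1O_mix p e₁ e₂ eo eb]
  rfl

/-- **`(i)` for every `a₃` adjacent exactly to `a₁`, `a₂`, `o` and `b`, every finite graph, every weight
vector.** -/
theorem zSplitI_of_markedStar (p : E → R) (hp : IsProbVec p)
    (h : IsMarkedStarAt ends o a₁ a₂ b a₃ e₁ e₂ eo eb) : ZSplitI p ends o a₁ a₂ a₃ b := by
  unfold ZSplitI
  rw [iExpr_eq_iQ4 p h]
  have hp0 : IsProbVec (pin4 p e₁ e₂ eo eb) :=
    (((hp.update e₁ le_rfl zero_le_one).update e₂ le_rfl zero_le_one).update eo le_rfl zero_le_one).update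
      eb le_rfl zero_le_one
  exact iQ4_nonneg _ _ _ _ _ (sFacts (pin4 p e₁ e₂ eo eb) hp0) (hp.nonneg e₁) (hp.le_one e₁)
    (hp.nonneg e₂) (hp.le_one e₂) (hp.nonneg eo) (hp.le_one eo) (hp.nonneg eb) (hp.le_one eb)

/-- **`(J1₁)` for the marked star**: from `(i)` and `(ii)`. -/
theorem jOneOne_of_markedStar (p : E → R) (hp : IsProbVec p)
    (h : IsMarkedStarAt ends o a₁ a₂ b a₃ e₁ e₂ eo eb) : JOneOne p ends o a₁ a₂ a₃ b :=
  jOneOne_of_i_of_ii p ends o a₁ a₂ a₃ b (zSplitI_of_markedStar p hp h) (zSplitII_of_markedStar p hp h)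

end ClosedI4

end CaseOne

end Summit.Ventures.PercRepro2
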